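import Summits.Ventures.YMGap.RobustBall.TermPerturbationWeighted
import Summits.Ventures.YMGap.RobustBall.PlaquetteMember
import Summits.Ventures.YMGap.RobustBall.ParallelPairCode
import Summits.Ventures.YMGap.RobustBall.TorusRange
import HarnessLib

/-!
# RobustBall/AxialTowerWitness — an INFINITE-RANGE slab-local member of the tier-2 ball on the torus: exponentially
decaying couplings of all axial plaquette pairs (cell `pub-ymgap`, track Y2 ROBUST-BALL; ds-4)

HONEST FRAMING: a MEMBERSHIP CERTIFICATE (finite-torus bookkeeping; no expansion, no continuum, no Clay claim) — the torus twin
of rb-p1's `ℤ^d` witness `AxialPairWitness`, aimed at the AREA-LAW sub-ball: the non-emptiness-beyond-tier-1 witness (referee test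
T0.2) for `ClusterDomain κ ε₀ ε₁ ∩ IsSlabLocal 2`, the hypothesis of `AreaLawOnBallW` (`RobustBall/AreaLawWDefs`, discharged in
`RobustBall/RobustAreaLawBallW`).  The AXIAL-TOWER action couples every plaquette `p = (x; i, j)` to its parallel translates
`p + s e_k` (`k ∉ {i, j}`, `s = 1, …, L`) with coefficient `τ θ^s / 2` per ordered triple:
`W = Σ_{x, (i,j,k), s} (τ θ^s/2) (Re tr U_p/N)(Re tr U_{p + s e_k}/N)`.
THIS FILE: the geometry (`towerCode`, diameter `≤ s + 1` — unbounded in `L`), the family and the witness (`towerFamily`, `towerWitness`),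
centre-slab invariance (balanced plaquette words) and VERTICAL DEPENDENCE DIAMETER `2` by one window per polymer
(`hasVertRange_towerWitness`, `isSlabLocal_towerWitness`).  The `L`-uniform weighted loads — membership in `ClusterDomain κ ε₀ ε₁` with
`ε₀ = 8(d−1)(d−2)|τ| e^{κ} q/(1−q)`, `ε₁ = 24 d(d−1)(d−2)(|τ|/√N) e^{κ} q/(1−q)`, `q = e^{κ}θ < 1` — and the INFINITE-RANGE certificate
(in no tier-1 ball `ClusterDomainFR ε₀ ε₁ r` once `L ≥ 2(r+1)`) are in `RobustBall/AxialTowerMember`.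
-/

noncomputable section

open MeasureTheory Finset Function
open Literature.Probability.LatticeModels Literature.Probability.LatticeModels.DobrushinMetric
open Literature.MathematicalPhysics.QuantumLattice hiding torusNorm
open Literature.MathematicalPhysics.QuantumFieldTheory hiding ZdEdge

namespace Summit.Ventures.YMGap.RobustBall

variable {d L N : ℕ}

/-! ### The tower polymer: two parallel plaquette codes `s = m + 1` steps apart along `e_k` -/

section Code

/-- The axial shift `(m+1) e_k` on the torus. [folklore] -/
def axialShiftT (k : Fin d) (m : ℕ) : Site d L := Pi.single k (((m + 1 : ℕ) : ℤ) : ZMod L)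

/-- The axial shift has periodic sup-norm `≤ m + 1`. [folklore] -/
theorem torusNorm_axialShiftT_le (k : Fin d) (m : ℕ) : torusNorm (axialShiftT k m : Site d L) ≤ m + 1 := by
  refine Finset.sup_le fun k' _ => ?_
  by_cases hk : k' = k
  · subst hk
    simp only [axialShiftT, Pi.single_eq_same]
    exact (natAbs_valMinAbs_intCast_le L ((m + 1 : ℕ) : ℤ)).trans (by omega)
  · simp [axialShiftT, Pi.single_eq_of_ne hk]

/-- Coordinates of the axial shift. [folklore] -/
theorem axialShiftT_apply_of_ne {k k' : Fin d} (h : k' ≠ k) (m : ℕ) : (axialShiftT k m : Site d L) k' = 0 := by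
  simp [axialShiftT, Pi.single_eq_of_ne h]

/-- The `k`-coordinate of the axial shift. [folklore] -/
theorem axialShiftT_apply_self (k : Fin d) (m : ℕ) : (axialShiftT k m : Site d L) k = ((m + 1 : ℕ) : ZMod L) := by
  simp [axialShiftT]

/-- The TOWER polymer: the plaquette code at `x` and its translate by `(m+1) e_k`. [folklore] -/
def towerCode (x : Site d L) (i j k : Fin d) (m : ℕ) : Finset (Site d L) :=
  plaqCode x i j ∪ plaqCode (x + axialShiftT k m) i j

/-- Every letter of the two plaquette words is based in the tower polymer. [folklore] -/
theorem site_mem_towerCode {x : Site d L} {i j k : Fin d} {m : ℕ} {l : Letter d L}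
    (hl : l ∈ plaqWord x i j ++ plaqWord (x + axialShiftT k m) i j) : l.site ∈ towerCode x i j k m := by
  rcases List.mem_append.1 hl with h | h
  · exact mem_union_left _ (site_mem_plaqCode h)
  · exact mem_union_right _ (site_mem_plaqCode h)

/-- Every point of the tower polymer is a point of the base plaquette code, possibly shifted by `(m+1) e_k`. [folklore] -/
theorem exists_base_of_mem_towerCode {x : Site d L} {i j k : Fin d} {m : ℕ} {p : Site d L} (hp : p ∈ towerCode x i j k m) :
    ∃ u ∈ plaqCode x i j, p = u ∨ p = u + axialShiftT k m := by
  rcases mem_union.1 hp with h | h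
  · exact ⟨p, h, Or.inl rfl⟩
  · simp only [plaqCode, mem_insert, mem_singleton] at h
    rcases h with rfl | rfl | rfl
    · exact ⟨x, by simp [plaqCode], Or.inr rfl⟩
    · exact ⟨x + unitVec i, by simp [plaqCode], Or.inr (by abel)⟩
    · exact ⟨x + unitVec j, by simp [plaqCode], Or.inr (by abel)⟩

/-- **The tower polymer has periodic sup-diameter `≤ m + 2`** (`i ≠ j`): unbounded in the separation, so the family has infinite
range. [folklore] -/
theorem polymerDiam_towerCode_le {x : Site d L} {i j k : Fin d} (hij : i ≠ j) (m : ℕ) :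
    polymerDiam (towerCode x i j k m) ≤ m + 2 := by
  have hpl : polymerDiam (plaqCode x i j) ≤ 1 := polymerDiam_plaqCode_le hij
  have hS : torusNorm (axialShiftT k m : Site d L) ≤ m + 1 := torusNorm_axialShiftT_le k m
  have key : ∀ p ∈ towerCode x i j k m, ∀ q ∈ towerCode x i j k m, torusNorm (p - q) ≤ m + 2 := by
    intro p hp q hq
    obtain ⟨u, hu, hpu⟩ := exists_base_of_mem_towerCode hp
    obtain ⟨u', hu', hqu⟩ := exists_base_of_mem_towerCode hq
    have huu : torusNorm (u - u') ≤ 1 := (torusNorm_sub_le_polymerDiam hu hu').trans hpl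
    rcases hpu with rfl | rfl <;> rcases hqu with rfl | rfl
    · omega
    · have h := torusNorm_add_le (p - u') (-(axialShiftT k m : Site d L))
      rw [torusNorm_neg] at h
      have e : p - (u' + axialShiftT k m) = p - u' + -axialShiftT k m := by abel
      rw [e]; omega
    · have h := torusNorm_add_le (u - q) (axialShiftT k m : Site d L)
      have e : u + axialShiftT k m - q = u - q + axialShiftT k m := by abel
      rw [e]; omega
    · have e : u + axialShiftT k m - (u' + axialShiftT k m) = u - u' := by abel
      rw [e]; omega
  unfold polymerDiam
  exact Finset.sup_le fun p hp => Finset.sup_le fun q hq => key p hp q hq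

/-- Coordinates of the tower polymer: off `{i, j, k}` every point agrees with `x`; in directions `i, j` it is `x_v` or `x_v + 1`;
in direction `k ∉ {i,j}` it is `x_k` or `x_k + (m+1)`. [folklore] -/
theorem apply_mem_towerCode {x : Site d L} {i j k : Fin d} (hij : i ≠ j) (hki : k ≠ i) (hkj : k ≠ j) {m : ℕ} {p : Site d L}
    (hp : p ∈ towerCode x i j k m) (v : Fin d) :
    (v ≠ k → p v = x v ∨ p v = x v + 1) ∧ (v = k → p v = x v ∨ p v = x v + ((m + 1 : ℕ) : ZMod L)) := by
  obtain ⟨u, hu, hpu⟩ := exists_base_of_mem_towerCode hp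
  obtain ⟨a, b, ha, hb, rfl⟩ := exists_offsets_of_mem_plaqCode hu
  set δ : Site d L := Pi.single i (a : ZMod L) + Pi.single j (b : ZMod L) with hδdef
  have hδ0 : ∀ w : Fin d, w ≠ i → w ≠ j → δ w = 0 := fun w hwi hwj => by
    simp [hδdef, Pi.single_eq_of_ne hwi, Pi.single_eq_of_ne hwj]
  have hδ01 : ∀ w : Fin d, δ w = 0 ∨ δ w = 1 := by
    intro w
    by_cases hwi : w = i
    · subst hwi
      have hji : j ≠ w := fun h => hij h.symm
      interval_cases a <;> simp [hδdef, Pi.single_eq_of_ne hij]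
    · by_cases hwj : w = j
      · subst hwj
        interval_cases b <;> simp [hδdef, Pi.single_eq_of_ne hwi]
      · exact Or.inl (hδ0 w hwi hwj)
  refine ⟨fun hvk => ?_, fun hvk => ?_⟩
  · have hS : (axialShiftT k m : Site d L) v = 0 := axialShiftT_apply_of_ne hvk m
    rcases hpu with rfl | rfl <;> rcases hδ01 v with h | h <;> simp [Pi.add_apply, h, hS]
  · subst hvk
    have h0 : δ v = 0 := hδ0 v hki hkj
    rcases hpu with rfl | rfl
    · left; simp [Pi.add_apply, h0]
    · right; simp [Pi.add_apply, h0, axialShiftT_apply_self]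

end Code

/-! ### The tower family and the witness -/

section Family

variable (N : ℕ) (τ θ : ℝ)

variable (d L) in
/-- The family of TOWER TERMS indexed by a base point, an ordered distinct triple `(i, j, k)` and a separation `m + 1`
(`m : Fin L`): activity `(τ θ^{m+1}/2)(Re tr U_p/N)(Re tr U_{p+(m+1)e_k}/N)`. [folklore] -/
def towerFamily (r : (Site d L × OTrip d) × Fin L) : LocalTerm d L N :=
  LocalTerm.ofPair N (τ * θ ^ ((r.2 : ℕ) + 1) / 2)
    (plaqWord r.1.1 r.1.2.1.1 r.1.2.1.2.1) (plaqWord (r.1.1 + axialShiftT r.1.2.1.2.2 r.2) r.1.2.1.1 r.1.2.1.2.1)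
    (towerCode r.1.1 r.1.2.1.1 r.1.2.1.2.1 r.1.2.1.2.2 r.2) r.1.1 (r.1.1 + axialShiftT r.1.2.1.2.2 r.2)
    (isWalk_plaqWord _ _ _) (isWalk_plaqWord _ _ _) fun _ hl => site_mem_towerCode hl

/-- The letters of a tower term. [folklore] -/
@[simp] theorem towerFamily_letters (r : (Site d L × OTrip d) × Fin L) :
    (towerFamily d L N τ θ r).letters =
      plaqWord r.1.1 r.1.2.1.1 r.1.2.1.2.1 ++ plaqWord (r.1.1 + axialShiftT r.1.2.1.2.2 r.2) r.1.2.1.1 r.1.2.1.2.1 := rfl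

/-- The polymer of a tower term. [folklore] -/
@[simp] theorem towerFamily_code (r : (Site d L × OTrip d) × Fin L) :
    (towerFamily d L N τ θ r).code = towerCode r.1.1 r.1.2.1.1 r.1.2.1.2.1 r.1.2.1.2.2 r.2 := rfl

/-- The oscillation constant of a tower term (`θ ≥ 0`): `|τ| θ^{m+1}`. [folklore] -/
theorem towerFamily_oscC (hθ : 0 ≤ θ) (r : (Site d L × OTrip d) × Fin L) :
    (towerFamily d L N τ θ r).oscC = |τ| * θ ^ ((r.2 : ℕ) + 1) := by
  show 2 * |τ * θ ^ ((r.2 : ℕ) + 1) / 2| = _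
  rw [abs_div, abs_mul, abs_pow, abs_of_nonneg hθ, abs_two]; ring

/-- The Lipschitz constant of a tower term (`θ ≥ 0`): `|τ| θ^{m+1}/(2√N)`. [folklore] -/
theorem towerFamily_lipC (hθ : 0 ≤ θ) (r : (Site d L × OTrip d) × Fin L) :
    (towerFamily d L N τ θ r).lipC = |τ| * θ ^ ((r.2 : ℕ) + 1) / 2 / Real.sqrt N := by
  show |τ * θ ^ ((r.2 : ℕ) + 1) / 2| / Real.sqrt N = _
  rw [abs_div, abs_mul, abs_pow, abs_of_nonneg hθ, abs_two]

/-- A tower term has eight letters. [folklore] -/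
@[simp] theorem towerFamily_length (r : (Site d L × OTrip d) × Fin L) : (towerFamily d L N τ θ r).letters.length = 8 := by
  simp [towerFamily_letters]

variable [NeZero L]

variable (d L) in
/-- **The axial-tower witness** on the torus `(ℤ/L)^d`. [folklore] -/
def towerWitness : Perturbation d L N := termPerturbation (towerFamily d L N τ θ)

omit [NeZero L] in
/-- **Centre-slab invariance** of every tower term (both plaquette words are balanced). [folklore] -/
theorem towerFamily_centerSlabRotate (r : (Site d L × OTrip d) × Fin L) (v : Fin d) (t : ZMod L) {z : SUN N}
    (hz : z ∈ Subgroup.center (SUN N)) (U : GaugeConfig d L (SUN N)) :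
    (towerFamily d L N τ θ r).act (centerSlabRotate v t z U) = (towerFamily d L N τ θ r).act U :=
  pairActivity_centerSlabRotate (netCount_plaqWord r.1.2.2.1) (netCount_plaqWord r.1.2.2.1) _ v t hz U

/-! ### Vertical dependence diameter `2` (one window per polymer) -/

omit [NeZero L] in
/-- A letter of a plaquette word points in one of the two plaquette directions. [folklore] -/
theorem dir_of_mem_plaqWord {y : Site d L} {i j : Fin d} {l : Letter d L} (hl : l ∈ plaqWord y i j) : l.dir = i ∨ l.dir = j := by
  simp only [plaqWord, List.mem_cons, List.mem_nil_iff, or_false] at hl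
  rcases hl with rfl | rfl | rfl | rfl <;> simp

omit [NeZero L] in
/-- If a plaquette word based at `y` has a `v`-letter then `y` and `y + e_v` lie in its code. [folklore] -/
theorem base_and_shift_mem_plaqCode {y : Site d L} {i j : Fin d} {l : Letter d L} (hl : l ∈ plaqWord y i j) :
    y ∈ plaqCode y i j ∧ y + unitVec l.dir ∈ plaqCode y i j := by
  refine ⟨by simp [plaqCode], ?_⟩
  rcases dir_of_mem_plaqWord hl with h | h <;> simp [plaqCode, h]

/-- A term of the tower family placed on the polymer `X` which reads a `v`-link forces two points of `X` one `e_v`-step apart.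
[folklore] -/
theorem exists_step_of_letter {X : Finset (Site d L)} {r : (Site d L × OTrip d) × Fin L}
    (hr : r ∈ fiber (towerFamily d L N τ θ) X) {l : Letter d L} (hl : l ∈ (towerFamily d L N τ θ r).letters) :
    ∃ y ∈ X, y + unitVec l.dir ∈ X := by
  have hX : towerCode r.1.1 r.1.2.1.1 r.1.2.1.2.1 r.1.2.1.2.2 r.2 = X := (mem_fiber _).1 hr
  rw [towerFamily_letters] at hl
  rw [← hX]
  rcases List.mem_append.1 hl with h | h
  · obtain ⟨h1, h2⟩ := base_and_shift_mem_plaqCode h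
    exact ⟨_, mem_union_left _ h1, mem_union_left _ h2⟩
  · obtain ⟨h1, h2⟩ := base_and_shift_mem_plaqCode h
    exact ⟨_, mem_union_right _ h1, mem_union_right _ h2⟩

omit [NeZero L] in
/-- Window bookkeeping in `ℤ/L`: if every value is `a` or `a + s` and some value `u` has `u + 1` also of that form, then all values
sit at two consecutive heights. [folklore] -/
theorem window_two_of_step {a s u : ZMod L} (hu : u = a ∨ u = a + s) (hu1 : u + 1 = a ∨ u + 1 = a + s) :
    ∃ t₀ : ZMod L, ∀ p : ZMod L, (p = a ∨ p = a + s) → ∃ c : ℕ, c < 2 ∧ p = t₀ + c := by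
  -- in each case `{a, a + s} ⊆ {t₀, t₀ + 1}` for a suitable `t₀`
  have collapse : (1 : ZMod L) = 0 → a + s = a := fun h10 =>
    calc a + s = a + s * 1 := by ring
      _ = a := by rw [h10]; ring
  have key : ∃ t₀ : ZMod L, (a = t₀ ∨ a = t₀ + 1) ∧ (a + s = t₀ ∨ a + s = t₀ + 1) := by
    rcases hu with hu | hu <;> rw [hu] at hu1 <;> rcases hu1 with h | h
    · exact ⟨a, Or.inl rfl, Or.inl (collapse (by simpa using h))⟩
    · exact ⟨a, Or.inl rfl, Or.inr h.symm⟩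
    · exact ⟨a + s, Or.inr h.symm, Or.inl rfl⟩
    · exact ⟨a, Or.inl rfl, Or.inl (collapse (by simpa using h))⟩
  obtain ⟨t₀, ha, has⟩ := key
  refine ⟨t₀, fun p hp => ?_⟩
  rcases hp with hp | hp <;> rw [hp]
  · rcases ha with h | h
    · exact ⟨0, by norm_num, by simp [h]⟩
    · exact ⟨1, by norm_num, by simpa using h⟩
  · rcases has with h | h
    · exact ⟨0, by norm_num, by simp [h]⟩
    · exact ⟨1, by norm_num, by simpa using h⟩

/-- **The axial-tower witness has vertical dependence diameter `2`.** For a polymer `X = towerCode x i j k m` and a direction `v`: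
off `k` every point of `X` sits at `v`-height `x_v` or `x_v + 1`; in direction `k` either no term on `X` reads a `k`-link, or two
points of `X` are one `e_k`-step apart and then all `k`-heights of `X` are consecutive (`window_two_of_step`). [folklore] -/
theorem hasVertRange_towerWitness : HasVertRange 2 (towerWitness d L N τ θ) := by
  classical
  refine hasVertRange_termPerturbation_of_fiber _ fun X v => ?_
  by_cases hX : ∃ r₀, r₀ ∈ fiber (towerFamily d L N τ θ) X
  · obtain ⟨r₀, hr₀⟩ := hX
    have hX0 : towerCode r₀.1.1 r₀.1.2.1.1 r₀.1.2.1.2.1 r₀.1.2.1.2.2 r₀.2 = X := (mem_fiber _).1 hr₀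
    obtain ⟨hij, hki, hkj⟩ := r₀.1.2.2
    -- every letter site of every term on `X` lies in `X`
    have hsite : ∀ r ∈ fiber (towerFamily d L N τ θ) X, ∀ l ∈ (towerFamily d L N τ θ r).letters, l.site ∈ X :=
      fun r hr l hl => (mem_fiber _).1 hr ▸ (towerFamily d L N τ θ r).site_mem l hl
    have hcoord : ∀ p ∈ X, (v ≠ r₀.1.2.1.2.2 → p v = r₀.1.1 v ∨ p v = r₀.1.1 v + 1) ∧
        (v = r₀.1.2.1.2.2 → p v = r₀.1.1 v ∨ p v = r₀.1.1 v + (((r₀.2 : ℕ) + 1 : ℕ) : ZMod L)) :=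
      fun p hp => apply_mem_towerCode hij hki hkj (hX0 ▸ hp : p ∈ towerCode _ _ _ _ _) v
    by_cases hvk : v = r₀.1.2.1.2.2
    · -- direction `k`
      by_cases hstep : ∃ y ∈ X, y + unitVec v ∈ X
      · obtain ⟨y, hy, hy1⟩ := hstep
        have hyk := (hcoord y hy).2 hvk
        have hy1k := (hcoord _ hy1).2 hvk
        have e1 : (y + unitVec v : Site d L) v = y v + 1 := by simp
        rw [e1] at hy1k
        obtain ⟨t₀, ht₀⟩ := window_two_of_step hyk hy1k
        exact ⟨t₀, fun r hr l hl _ => ht₀ (l.site v) ((hcoord _ (hsite r hr l hl)).2 hvk)⟩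
      · -- no two points of `X` differ by `e_v`: no term on `X` reads a `v`-link
        refine ⟨0, fun r hr l hl hlv => ?_⟩
        obtain ⟨y, hy, hy'⟩ := exists_step_of_letter N τ θ hr hl
        exact absurd ⟨y, hy, (hlv ▸ hy' : y + unitVec v ∈ X)⟩ hstep
    · -- direction `v ≠ k`: heights `x_v`, `x_v + 1`
      refine ⟨r₀.1.1 v, fun r hr l hl _ => ?_⟩
      rcases (hcoord _ (hsite r hr l hl)).1 hvk with h | h
      · exact ⟨0, by norm_num, by simp [h]⟩
      · exact ⟨1, by norm_num, by simpa using h⟩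
  · exact ⟨0, fun r hr _ _ _ => absurd ⟨r, hr⟩ hX⟩

/-- **The axial-tower witness is slab-local with vertical dependence diameter `2`** (centre invariance from balanced words). [folklore] -/
theorem isSlabLocal_towerWitness : IsSlabLocal 2 (towerWitness d L N τ θ) :=
  ⟨fun v t _ hz U => total_centerSlabRotate _ (fun r v t _ hz U => towerFamily_centerSlabRotate N τ θ r v t hz U) v t hz U,
    hasVertRange_towerWitness N τ θ⟩

end Family

end Summit.Ventures.YMGap.RobustBall

end
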